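import Literature.Probability.RandomPlanarGeometry.PolygonLog
import Literature.Probability.RandomPlanarGeometry.USTPeanoSetting
import HarnessLib

/-!
# The argument along a polyline seen counterclockwise is continuous and monotone

Tools for the reparametrisation bounds `ρ(α^R, Rα_D) ≤ 10` of the grid approximations of the
disc ([LSW04] §4.3, `USTPeano.IsApproximation`): for a polyline `pathCurve L` (uniform time per
edge, `USTPeanoSetting.lean`) whose vertices lie in the closed upper half-plane and whose edges
are seen strictly counterclockwise from the origin, the argument `t ↦ arg (pathCurve L t)` is
monotone on `[0, 1]`, and continuous when no vertex except possibly the last is a negative real;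
then `t ↦ arg (pathCurve L t) / π` is an admissible (weakly increasing) time change matching the
polyline with the circle of directions.

* `exists_pathCurve_eq_lineMap` — every point of the polyline is on an edge `[L[k], L[k+1]]`;
* `ne_zero_of_mem_segment_of_cross_pos`, `arg_lineMap_le_arg_lineMap` — on an edge seen
  counterclockwise, points are nonzero and the argument is monotone;
* `monotone_of_monotoneOn_pieces` — gluing monotonicity over the `n` parameter intervals;
* `monotone_arg_pathCurve`, `pathCurve_mem_slitPlane`, `continuous_arg_pathCurve`.
-/

noncomputable section

open Set Function Complex
open scoped unitInterval

namespace Literature.Probability.RandomPlanarGeometry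

open USTPeano (pathCurve pathCurve_apply)

/-! ### Points of a polyline are on edges -/

/-- **Every point of the polyline through `L` (`|L| ≥ 2`) lies on an edge**: for `t ∈ [0, 1]`
there are `k` with `k + 1 < |L|` and `s ∈ [0, 1]` with `(|L| - 1) t = k + s` and
`pathCurve L t = lineMap L[k] L[k+1] s`. [folklore] -/
theorem exists_pathCurve_eq_lineMap {L : List ℂ} (hL : 2 ≤ L.length) (t : I) :
    ∃ (k : ℕ) (hk : k + 1 < L.length) (s : ℝ), s ∈ Icc (0 : ℝ) 1 ∧
      ((L.length : ℝ) - 1) * t = k + s ∧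
      pathCurve L t = AffineMap.lineMap (L[k]'(by omega)) (L[k + 1]'hk) s := by
  set x : ℝ := ((L.length : ℝ) - 1) * t with hx
  have hn : (1 : ℝ) ≤ (L.length : ℝ) - 1 := by
    have : (2 : ℝ) ≤ L.length := by exact_mod_cast hL
    linarith
  have hx0 : 0 ≤ x := mul_nonneg (by linarith) t.2.1
  have hx1 : x ≤ (L.length : ℝ) - 1 := by
    have := t.2.2
    have h1 : ((L.length : ℝ) - 1) * t ≤ ((L.length : ℝ) - 1) * 1 :=
      mul_le_mul_of_nonneg_left this (by linarith)
    linarith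
  rcases hx1.lt_or_eq with hlt | heq
  · have h1 : (⌊x⌋₊ : ℝ) ≤ x := Nat.floor_le hx0
    have h2 := Nat.lt_floor_add_one x
    have hk : ⌊x⌋₊ + 1 < L.length := by
      have h3 : (⌊x⌋₊ : ℝ) + 1 < L.length := by linarith
      exact_mod_cast h3
    refine ⟨⌊x⌋₊, hk, x - ⌊x⌋₊, ⟨by linarith, by linarith⟩, by ring, ?_⟩
    rw [pathCurve_apply, ← hx, affineInterp_eq_lineMap L ⌊x⌋₊ hk ⟨h1, h2.le⟩]
  · obtain ⟨n, hnl⟩ : ∃ n, L.length = n + 2 := ⟨L.length - 2, by omega⟩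
    have hxn : x - n = 1 := by rw [heq, hnl]; push_cast; ring
    refine ⟨n, by omega, 1, ⟨zero_le_one, le_rfl⟩, ?_, ?_⟩
    · rw [heq, hnl]; push_cast; ring
    · rw [pathCurve_apply, ← hx, affineInterp_eq_lineMap L n (by omega) ⟨by linarith, by linarith⟩,
        hxn]

/-! ### An edge seen counterclockwise -/

/-- On (the line of) an edge seen strictly counterclockwise from `0` no point is `0`. [folklore] -/
theorem lineMap_ne_zero_of_cross_pos {p q : ℂ} (h : 0 < cross p q) (s : ℝ) :
    AffineMap.lineMap p q s ≠ 0 := by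
  intro h0
  rw [AffineMap.lineMap_apply_module'] at h0
  -- cross with `p` and with `q`
  have e1 : cross p (s • (q - p) + p) = s * cross p q := by
    simp [cross]; ring
  have e2 : cross (s • (q - p) + p) q = (1 - s) * cross p q := by
    simp [cross]; ring
  rw [h0] at e1 e2
  have hc : p.re * q.im - p.im * q.re ≠ 0 := by rw [cross] at h; exact h.ne'
  simp [cross] at e1 e2
  rcases e1 with h1 | h1
  · rcases e2 with h2 | h2
    · linarith
    · exact hc h2
  · exact hc h1

/-- Cross product of two points of the same edge. [folklore] -/
theorem cross_lineMap_lineMap (p q : ℂ) (s s' : ℝ) :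
    cross (AffineMap.lineMap p q s) (AffineMap.lineMap p q s') = (s' - s) * cross p q := by
  simp [cross, AffineMap.lineMap_apply_module']
  ring

/-- Imaginary part of a point of an edge. [folklore] -/
theorem im_lineMap (p q : ℂ) (s : ℝ) :
    (AffineMap.lineMap p q s).im = (1 - s) * p.im + s * q.im := by
  simp [AffineMap.lineMap_apply_module']
  ring

/-- **On an edge seen counterclockwise the argument is monotone**: for `p, q` in the closed upper
half-plane with `cross p q > 0`, `s ≤ s'` in `[0, 1]` gives
`arg (lineMap p q s) ≤ arg (lineMap p q s')`. [folklore] -/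
theorem arg_lineMap_le_arg_lineMap {p q : ℂ} (hp : 0 ≤ p.im) (hq : 0 ≤ q.im) (h : 0 < cross p q)
    {s s' : ℝ} (hs : s ∈ Icc (0 : ℝ) 1) (hs' : s' ∈ Icc (0 : ℝ) 1) (hss' : s ≤ s') :
    arg (AffineMap.lineMap p q s) ≤ arg (AffineMap.lineMap p q s') := by
  rcases hss'.eq_or_lt with rfl | hlt
  · exact le_rfl
  have hcross : 0 < cross (AffineMap.lineMap p q s) (AffineMap.lineMap p q s') := by
    rw [cross_lineMap_lineMap]; exact mul_pos (by linarith) h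
  have him' : 0 ≤ (AffineMap.lineMap p q s').im := by
    rw [im_lineMap]; exact add_nonneg (mul_nonneg (by linarith [hs'.2]) hp) (mul_nonneg hs'.1 hq)
  rcases him'.lt_or_eq with hpos | h0
  · exact (arg_lt_arg_of_cross_pos hpos hcross).le
  · -- the later point is real: it must be `q = lineMap 1`, a negative real, of argument `π`
    have hv0 := lineMap_ne_zero_of_cross_pos h s'
    rw [im_lineMap] at h0
    have h1 : (1 - s') * p.im = 0 := by
      have := mul_nonneg hs'.1 hq
      have := mul_nonneg (by linarith [hs'.2] : (0 : ℝ) ≤ 1 - s') hp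
      linarith
    have h2 : s' * q.im = 0 := by linarith
    have hs'1 : s' = 1 := by
      by_contra hne
      have hlt1 : s' < 1 := lt_of_le_of_ne hs'.2 hne
      have hpim : p.im = 0 := by
        rcases mul_eq_zero.1 h1 with h | h
        · exfalso; linarith
        · exact h
      have hs'0 : 0 < s' := lt_of_le_of_lt hs.1 hlt
      have hqim : q.im = 0 := by
        rcases mul_eq_zero.1 h2 with h | h
        · exfalso; linarith
        · exact h
      rw [cross, hpim, hqim] at h
      simp at h
    subst hs'1
    simp only [AffineMap.lineMap_apply_one] at hv0 ⊢
    have hqim : q.im = 0 := by simpa using h2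
    -- `q` is a negative real (a positive one would need `im p < 0`)
    have hqre : q.re < 0 := by
      rw [cross, hqim] at h
      have : q.re ≠ 0 := fun h0 ↦ hv0 (Complex.ext h0 hqim)
      rcases lt_or_gt_of_ne this with hlt | hgt
      · exact hlt
      · nlinarith
    rw [(Complex.arg_eq_pi_iff.2 ⟨hqre, hqim⟩)]
    exact Complex.arg_le_pi _

/-! ### Gluing monotonicity over the parameter intervals -/

/-- **Gluing**: a function on `[0, 1]` which is monotone on each of the `n` intervals
`[k/n, (k+1)/n]` is monotone. [folklore] -/
theorem monotone_of_monotoneOn_pieces {f : I → ℝ} {n : ℕ} (hn : 0 < n)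
    (h : ∀ k : ℕ, k < n → MonotoneOn f {t : I | (k : ℝ) / n ≤ (t : ℝ) ∧ (t : ℝ) ≤ (k + 1) / n}) :
    Monotone f := by
  have hnr : (0 : ℝ) < n := by exact_mod_cast hn
  -- monotone on `[0, k/n]` by induction on `k`
  have key : ∀ k : ℕ, k ≤ n → MonotoneOn f {t : I | (t : ℝ) ≤ (k : ℝ) / n} := by
    intro k
    induction k with
    | zero =>
      intro _ a ha b hb hab
      have ha0 : (a : ℝ) = 0 := le_antisymm (by simpa using ha) a.2.1
      have hb0 : (b : ℝ) = 0 := le_antisymm (by simpa using hb) b.2.1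
      have : a = b := Subtype.ext (ha0.trans hb0.symm)
      rw [this]
    | succ k ih =>
      intro hk
      have hk' : k < n := by omega
      have hkn : (k : ℝ) / n ≤ 1 := by rw [div_le_one hnr]; exact_mod_cast hk'.le
      set c : I := ⟨(k : ℝ) / n, div_nonneg (by positivity) hnr.le, hkn⟩ with hc
      have h1 := ih (by omega)
      have h2 := h k hk'
      have hunion : {t : I | (t : ℝ) ≤ ((k + 1 : ℕ) : ℝ) / n} =
          {t : I | (t : ℝ) ≤ (k : ℝ) / n} ∪ {t : I | (k : ℝ) / n ≤ (t : ℝ) ∧ (t : ℝ) ≤ (k + 1) / n} := by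
        ext t
        simp only [mem_setOf_eq, mem_union, Nat.cast_add, Nat.cast_one]
        constructor
        · intro ht
          rcases le_or_gt (t : ℝ) ((k : ℝ) / n) with h | h
          · exact Or.inl h
          · exact Or.inr ⟨h.le, ht⟩
        · rintro (ht | ht)
          · exact ht.trans (by gcongr; linarith)
          · exact ht.2
      rw [hunion]
      have hcs : c ∈ {t : I | (t : ℝ) ≤ (k : ℝ) / n} := show (k : ℝ) / n ≤ (k : ℝ) / n from le_rfl
      have hct : c ∈ {t : I | (k : ℝ) / n ≤ (t : ℝ) ∧ (t : ℝ) ≤ (k + 1) / n} :=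
        ⟨show (k : ℝ) / n ≤ (k : ℝ) / n from le_rfl,
          show (k : ℝ) / n ≤ (k + 1) / n by gcongr; linarith⟩
      refine MonotoneOn.union_right h1 h2 ⟨hcs, fun t ht ↦ ?_⟩ ⟨hct, fun t ht ↦ ?_⟩
      · exact Subtype.coe_le_coe.1 ht
      · exact Subtype.coe_le_coe.1 ht.1
  have := key n le_rfl
  rw [div_self hnr.ne'] at this
  exact fun a b hab ↦ this (a.2.2) (b.2.2) hab

/-! ### The argument along a polyline -/

section PathCurve

variable {L : List ℂ}

/-- Under the counterclockwise hypothesis the polyline avoids `0`. [folklore] -/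
theorem pathCurve_ne_zero (hL : 2 ≤ L.length) (hc : L.IsChain fun p q ↦ 0 < cross p q) (t : I) :
    pathCurve L t ≠ 0 := by
  obtain ⟨k, hk, s, hs, -, h⟩ := exists_pathCurve_eq_lineMap hL t
  rw [h]
  exact lineMap_ne_zero_of_cross_pos (hc.getElem k hk) s

/-- With vertices in the closed upper half-plane the polyline stays there. [folklore] -/
theorem pathCurve_im_nonneg (hL : 2 ≤ L.length) (him : ∀ p ∈ L, 0 ≤ p.im) (t : I) :
    0 ≤ (pathCurve L t).im := by
  obtain ⟨k, hk, s, hs, -, h⟩ := exists_pathCurve_eq_lineMap hL t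
  rw [h, im_lineMap]
  exact add_nonneg (mul_nonneg (by linarith [hs.2]) (him _ (List.getElem_mem _)))
    (mul_nonneg hs.1 (him _ (List.getElem_mem _)))

/-- The norm of a point of the polyline is within the edge length of the norm of a vertex: if all
vertices have norm in `[r, R]` and all edges length `≤ 1`, all points have norm in
`[r - 1, R]`. [folklore] -/
theorem norm_pathCurve_mem (hL : 2 ≤ L.length) {r R : ℝ} (hr : ∀ p ∈ L, r ≤ ‖p‖)
    (hR : ∀ p ∈ L, ‖p‖ ≤ R) (hstep : L.IsChain fun p q ↦ ‖q - p‖ ≤ 1) (t : I) :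
    r - 1 ≤ ‖pathCurve L t‖ ∧ ‖pathCurve L t‖ ≤ R := by
  obtain ⟨k, hk, s, hs, -, h⟩ := exists_pathCurve_eq_lineMap hL t
  rw [h]
  have hp := hr _ (List.getElem_mem (by omega : k < L.length))
  have hP := hR _ (List.getElem_mem (by omega : k < L.length))
  have hQ := hR _ (List.getElem_mem hk)
  have hd := hstep.getElem k hk
  constructor
  · have : ‖AffineMap.lineMap (L[k]'(by omega)) (L[k + 1]'hk) s - L[k]'(by omega)‖ ≤ 1 := by
      rw [AffineMap.lineMap_apply_module', add_sub_cancel_right, norm_smul, Real.norm_eq_abs,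
        abs_of_nonneg hs.1]
      nlinarith [norm_nonneg (L[k + 1]'hk - L[k]'(by omega)), hs.2]
    have h1 := norm_sub_norm_le (L[k]'(by omega)) (AffineMap.lineMap (L[k]'(by omega)) (L[k + 1]'hk) s)
    rw [norm_sub_rev] at h1
    linarith
  · rw [AffineMap.lineMap_apply_module']
    calc ‖s • (L[k + 1]'hk - L[k]'(by omega)) + L[k]'(by omega)‖
        = ‖s • L[k + 1]'hk + (1 - s) • L[k]'(by omega)‖ := by congr 1; module
      _ ≤ ‖s • L[k + 1]'hk‖ + ‖(1 - s) • L[k]'(by omega)‖ := norm_add_le _ _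
      _ = s * ‖L[k + 1]'hk‖ + (1 - s) * ‖L[k]'(by omega)‖ := by
          rw [norm_smul, norm_smul, Real.norm_eq_abs, Real.norm_eq_abs, abs_of_nonneg hs.1,
            abs_of_nonneg (by linarith [hs.2])]
      _ ≤ s * R + (1 - s) * R := by gcongr <;> linarith [hs.1, hs.2]
      _ = R := by ring

/-- **The argument is monotone along a polyline seen counterclockwise** with vertices in the
closed upper half-plane. [folklore] -/
theorem monotone_arg_pathCurve (hL : 2 ≤ L.length) (him : ∀ p ∈ L, 0 ≤ p.im)
    (hc : L.IsChain fun p q ↦ 0 < cross p q) : Monotone fun t : I ↦ arg (pathCurve L t) := by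
  obtain ⟨n, hn⟩ : ∃ n, L.length = n + 1 := ⟨L.length - 1, by omega⟩
  have hn0 : 0 < n := by omega
  have hnr : (0 : ℝ) < n := by exact_mod_cast hn0
  have hlen : (L.length : ℝ) - 1 = n := by rw [hn]; push_cast; ring
  refine monotone_of_monotoneOn_pieces hn0 fun k hk ↦ ?_
  intro a ha b hb hab
  have hk1 : k + 1 < L.length := by omega
  -- on the `k`-th piece the polyline is `lineMap L[k] L[k+1] (n t - k)`
  have hpiece : ∀ t : I, (k : ℝ) / n ≤ (t : ℝ) → (t : ℝ) ≤ (k + 1) / n →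
      (n : ℝ) * (t : ℝ) - k ∈ Icc (0 : ℝ) 1 ∧
        pathCurve L t = AffineMap.lineMap (L[k]'(by omega)) (L[k + 1]'hk1) ((n : ℝ) * (t : ℝ) - k) := by
    intro t h1 h2
    rw [div_le_iff₀ hnr] at h1
    rw [le_div_iff₀ hnr] at h2
    have hs : (n : ℝ) * (t : ℝ) - k ∈ Icc (0 : ℝ) 1 := ⟨by linarith, by linarith⟩
    refine ⟨hs, ?_⟩
    rw [pathCurve_apply, hlen, affineInterp_eq_lineMap L k hk1 ⟨by linarith, by linarith⟩]
  obtain ⟨hsa, ea⟩ := hpiece a ha.1 ha.2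
  obtain ⟨hsb, eb⟩ := hpiece b hb.1 hb.2
  show arg (pathCurve L a) ≤ arg (pathCurve L b)
  rw [ea, eb]
  refine arg_lineMap_le_arg_lineMap (him _ (List.getElem_mem _)) (him _ (List.getElem_mem _))
    (hc.getElem k hk1) hsa hsb ?_
  have : (a : ℝ) ≤ b := hab
  nlinarith

/-- **Off the last vertex the polyline lies in the slit plane** when no vertex before the last is
a negative real (or zero): for `t < 1`, `pathCurve L t ∈ slitPlane`. [folklore] -/
theorem pathCurve_mem_slitPlane (hL : 2 ≤ L.length) (him : ∀ p ∈ L, 0 ≤ p.im)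
    (hc : L.IsChain fun p q ↦ 0 < cross p q)
    (hslit : L.IsChain fun p _ ↦ 0 < p.im ∨ 0 < p.re) {t : I} (ht : (t : ℝ) < 1) :
    pathCurve L t ∈ slitPlane := by
  obtain ⟨k, hk, s, hs, hts, h⟩ := exists_pathCurve_eq_lineMap hL t
  rw [h, Complex.mem_slitPlane_iff]
  have hp := him _ (List.getElem_mem (by omega : k < L.length))
  have hq := him _ (List.getElem_mem hk)
  have hpk := hslit.getElem k hk
  have himv : 0 ≤ (AffineMap.lineMap (L[k]'(by omega)) (L[k + 1]'hk) s).im := by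
    rw [im_lineMap]; exact add_nonneg (mul_nonneg (by linarith [hs.2]) hp) (mul_nonneg hs.1 hq)
  rcases himv.lt_or_eq with hpos | h0
  · exact Or.inr hpos.ne'
  · rw [im_lineMap] at h0
    have h1 : (1 - s) * (L[k]'(by omega)).im = 0 := by
      have := mul_nonneg hs.1 hq
      have := mul_nonneg (by linarith [hs.2] : (0 : ℝ) ≤ 1 - s) hp
      linarith
    have h2 : s * (L[k + 1]'hk).im = 0 := by linarith
    rcases hs.1.eq_or_lt with rfl | hs0
    · -- `s = 0`: the point is the vertex `L[k]`, not a negative real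
      simp only [AffineMap.lineMap_apply_zero]
      rcases hpk with h | h
      · simp at h1; linarith
      · exact Or.inl h
    rcases hs.2.lt_or_eq with hs1 | rfl
    · -- `0 < s < 1`: both endpoints real, contradicting `cross > 0`
      exfalso
      have hpim : (L[k]'(by omega)).im = 0 := by
        rcases mul_eq_zero.1 h1 with h | h
        · exfalso; linarith
        · exact h
      have hqim : (L[k + 1]'hk).im = 0 := by
        rcases mul_eq_zero.1 h2 with h | h
        · exfalso; linarith
        · exact h
      have := hc.getElem k hk
      rw [cross, hpim, hqim] at this
      simp at this
    · -- `s = 1`: the point is `L[k+1]`; it is not the last vertex since `t < 1`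
      simp only [AffineMap.lineMap_apply_one]
      have hk2 : k + 2 < L.length := by
        by_contra hge
        have hkl : (k : ℝ) + 1 = (L.length : ℝ) - 1 := by
          have : k + 2 = L.length := by omega
          rw [← this]; push_cast; ring
        -- then `(|L| - 1) t = |L| - 1`, i.e. `t = 1`
        have hlen : (0 : ℝ) < (L.length : ℝ) - 1 := by
          have : (2 : ℝ) ≤ L.length := by exact_mod_cast hL
          linarith
        have h' : ((L.length : ℝ) - 1) * t = ((L.length : ℝ) - 1) * 1 := by rw [mul_one, hts, hkl]
        have := mul_left_cancel₀ hlen.ne' h'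
        exact absurd this ht.ne
      rcases hslit.getElem (k + 1) hk2 with h | h
      · have hqim : (L[k + 1]'hk).im = 0 := by simpa using h2
        linarith
      · exact Or.inl h

/-- **The argument is continuous along such a polyline**, as a function on `[0, 1]`: at
parameters `t < 1` the point is in the slit plane; at `t = 1` the point may be a negative real,
where the argument is continuous within the closed upper half-plane, which contains the
polyline. [folklore] -/
theorem continuous_arg_pathCurve (hL : 2 ≤ L.length) (him : ∀ p ∈ L, 0 ≤ p.im)
    (hc : L.IsChain fun p q ↦ 0 < cross p q)
    (hslit : L.IsChain fun p _ ↦ 0 < p.im ∨ 0 < p.re) :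
    Continuous fun t : I ↦ arg (pathCurve L t) := by
  have hcont : Continuous fun t : I ↦ pathCurve L t := (pathCurve L).continuous
  rw [continuous_iff_continuousAt]
  intro t
  rcases lt_or_eq_of_le t.2.2 with ht | ht
  · exact (continuousAt_arg (pathCurve_mem_slitPlane hL him hc hslit ht)).comp hcont.continuousAt
  · -- `t = 1`
    by_cases hmem : pathCurve L t ∈ slitPlane
    · exact (continuousAt_arg hmem).comp hcont.continuousAt
    · have h0 := pathCurve_ne_zero hL hc t
      rw [Complex.mem_slitPlane_iff, not_or, not_lt] at hmem
      have him0 : (pathCurve L t).im = 0 := by simpa using hmem.2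
      have hre : (pathCurve L t).re < 0 := by
        rcases hmem.1.lt_or_eq with h | h
        · exact h
        · exact absurd (Complex.ext h him0) h0
      have hw := continuousWithinAt_arg_of_re_neg_of_im_zero hre him0
      have hmaps : MapsTo (fun t : I ↦ pathCurve L t) univ {z : ℂ | 0 ≤ z.im} := fun u _ ↦
        pathCurve_im_nonneg hL him u
      have := hw.comp hcont.continuousWithinAt hmaps
      rwa [continuousWithinAt_univ] at this

end PathCurve

end Literature.Probability.RandomPlanarGeometry
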